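import Summits.AnomalousDissipation.AnomalousDissipation.Theses.TaylorCertificates

/-!
# Sketch — crux ideas for `TaylorCertificates.SteadyStatesLoudBounded` (stmt-AnomalousDissipation-13038)

First lemmas of the three crux idea cards of ideator 3 (round 1; gen-1 seat
planner-cruxidea-stmt-AnomalousDissipation-13038-3-0, revised and extended by gen-2 seat
planner-cruxidea-stmt-AnomalousDissipation-13038-3-g2-0).  Statements only (sorried); they must
elaborate over existing declarations.

* `steadyCeiling_of_smallForceDomination` — card `small-force-lamb-excess-ceiling`.
* `beltrami_firstIntegral_mem_cokernel`   — card `kam-channel-rigidity-quiet-baths`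
  (also the leading-order obstruction behind the first card's margin).
* `work_eq_viscous_on_invariantMeasure`, `work_eq_viscous_firstIntegral`,
  `kelvin_batchelor_closedStreamline`, `shear_sector_mem_cokernel` — card
  `kelvin-batchelor-work-coboundary` (the forced Kelvin–Batchelor law: on every invariant measure of
  a steady state's own flow the work equals the viscous term).
-/

open MeasureTheory

noncomputable section

namespace Summit.AnomalousDissipation.AnomalousDissipation.Cruxes.SteadyStatesLoudBounded.Sketch

open Literature.Analysis.FunctionSpaces

local notation "𝕋³" => UnitAddTorus (Fin 3)
local notation "E³" => EuclideanSpace ℝ (Fin 3)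

/-- The smooth, divergence-free, mean-zero class (states, forces and test fields of the crux). -/
def IsTest (w : 𝕋³ → E³) : Prop :=
  Torus.IsSmooth w ∧ Torus.IsDivFree w ∧ Torus.HasZeroMean w

/-- `u` is a steady weak state of `NS_ν(f)` in the crux's exact sense
(tested against smooth div-free mean-zero `w`; pressure-free). -/
def IsSteady (ν : ℝ) (f u : 𝕋³ → E³) : Prop :=
  IsTest u ∧ ∀ w : 𝕋³ → E³, IsTest w →
    ∫ x, inner ℝ (ν • Torus.laplacian u x - Torus.convect u u x + f x) (w x) = 0

/-- Work `(f,u) = ∫⟪f,u⟫`. -/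
def work (f u : 𝕋³ → E³) : ℝ := ∫ x, inner ℝ (f x) (u x)

/-- Lamb pairing `(B(v,v) − g, w) = ∫⟪(v·∇)v − g, w⟫` (for div-free `w` the Leray projector and the
pressure drop out, so the sup over `‖∇w‖ ≤ 1` of this pairing is the `Ḣ⁻¹` norm of `P[(v·∇)v] − g`). -/
def lambPair (g v w : 𝕋³ → E³) : ℝ := ∫ x, inner ℝ (Torus.convect v v x - g x) (w x)

/-- SMALL-FORCE LAMB DOMINATION of `f` with margin `m` below amplitude `t₀`:
for every `t ∈ (0,t₀)` and every unit-energy smooth div-free mean-zero profile `v` some unit-`Ḣ¹`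
test field `w` witnesses `‖P[(v·∇)v] − t f‖_{Ḣ⁻¹} · ‖∇v‖ ≥ t((f,v) + m)`, i.e. the virtual
dissipation of `v` against the small force `t f` strictly dominates the work `t(f,v)`. -/
def SmallForceDomination (f : 𝕋³ → E³) (t₀ m : ℝ) : Prop :=
  ∀ t : ℝ, 0 < t → t < t₀ → ∀ v : 𝕋³ → E³, IsTest v → (∫ x, ‖v x‖ ^ 2) = 1 →
    ∃ w : 𝕋³ → E³, IsTest w ∧ Torus.gradNormSq w ≤ 1 ∧
      t * (work f v + m) ≤ lambPair (t • f) v w * Real.sqrt (Torus.gradNormSq v)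

/-- The CEILING clause of the crux for the force `f`: steady states of every viscosity `ν < ν₀`
have energy `≤ E`. -/
def SteadyCeiling (f : 𝕋³ → E³) (E ν₀ : ℝ) : Prop :=
  ∀ ν : ℝ, 0 < ν → ν < ν₀ → ∀ u : 𝕋³ → E³, IsSteady ν f u → (∫ x, ‖u x‖ ^ 2) ≤ E

/-- The FLOOR clause of the crux for the force `f`. -/
def SteadyFloor (f : 𝕋³ → E³) (ε₀ ν₀ : ℝ) : Prop :=
  ∀ ν : ℝ, 0 < ν → ν < ν₀ → ∀ u : 𝕋³ → E³, IsSteady ν f u → ε₀ ≤ ν * Torus.gradNormSq u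

/-- Sanity: the crux is exactly `∃ f, FLOOR ∧ CEILING` in this bundling (unbundle the hypotheses). -/
theorem steadyStatesLoudBounded_iff :
    Theses.TaylorCertificates.SteadyStatesLoudBounded ↔
      ∃ f : 𝕋³ → E³, IsTest f ∧ ∃ ε₀ E ν₀ : ℝ, 0 < ε₀ ∧ 0 < ν₀ ∧
        SteadyFloor f ε₀ ν₀ ∧ SteadyCeiling f E ν₀ := by
  sorry

/-- **First lemma of card `small-force-lamb-excess-ceiling` (transfer, provable now).**
Small-force domination with a positive margin gives the energy ceiling `E = 1/t₀` for the steady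
states of EVERY viscosity (hence for `ν < ν₀` whatever `ν₀`).  Proof sketch: a steady state `u` with
energy `E_u > 1/t₀` rescales to the unit profile `v = u/√E_u` with `t = 1/E_u < t₀`; the steady
equation gives `P[(v·∇)v] − t f = (ν/√E_u) Δv`, so for every unit test field `w`,
`lambPair (t•f) v w · ‖∇v‖ ≤ (ν/√E_u)‖∇v‖² = t (f,v)` (energy identity `ν‖∇u‖² = (f,u)`),
contradicting domination with `m > 0`. -/
theorem steadyCeiling_of_smallForceDomination (f : 𝕋³ → E³) (t₀ m : ℝ) (ht₀ : 0 < t₀)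
    (hm : 0 < m) (hf : IsTest f) (h : SmallForceDomination f t₀ m) (ν₀ : ℝ) :
    SteadyCeiling f (1 / t₀) ν₀ := by
  sorry

/-- The curl on `T³` through the accepted `Torus.partialDeriv` (same formula as `BDSV.curl`). -/
def curl3 (v : 𝕋³ → E³) (x : 𝕋³) : E³ :=
  let D : Fin 3 → Fin 3 → ℝ := fun j i => Torus.partialDeriv j v x i
  WithLp.toLp 2 ![D 1 2 - D 2 1, D 2 0 - D 0 2, D 0 1 - D 1 0]

/-- **First lemma of card `kam-channel-rigidity-quiet-baths` (provable now, one integration by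
parts).**  For a Beltrami field `V` (`curl V = λ V`) and a first integral `ψ` of `V` (`V·∇ψ = 0`),
the divergence-free field `ψ V` annihilates the range of the linearised Lamb map
`L_V w = P[(V·∇)w + (w·∇)V]`:  `∫⟪(V·∇)w + (w·∇)V, ψ V⟫ = 0` for every smooth div-free `w`.
(General identity: the integral equals `∫ ψ ⟪w, V × curl V⟫`; Beltrami kills the Lamb vector.)
These cokernel elements — with `ψ` a Lipschitz devil's staircase on a KAM tube family — are the
channels/obstructions used by both cards. -/
theorem beltrami_firstIntegral_mem_cokernel (V w : 𝕋³ → E³) (ψ : 𝕋³ → ℝ) (lam : ℝ)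
    (hV : Torus.IsSmooth V) (hw : Torus.IsSmooth w) (hψ : Torus.IsSmooth ψ)
    (hVdiv : Torus.IsDivFree V) (hwdiv : Torus.IsDivFree w)
    (hB : ∀ x, curl3 V x = lam • V x)
    (hfi : ∀ x, inner ℝ (V x) (Torus.gradient ψ x) = 0) :
    ∫ x, inner ℝ (Torus.convect V w x + Torus.convect w V x) (ψ x • V x) = 0 := by
  sorry

/-- The two cards' joint reduction of the crux for one force: FLOOR is delegated to Lamb rigidity
(hub card virtual-dissipation-magic-cone, K1) and CEILING to small-force domination. -/
theorem crux_of_floor_and_domination (f : 𝕋³ → E³) (hf : IsTest f) (ε₀ t₀ m ν₀ : ℝ)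
    (hε : 0 < ε₀) (ht₀ : 0 < t₀) (hm : 0 < m) (hν₀ : 0 < ν₀)
    (hfloor : SteadyFloor f ε₀ ν₀) (hdom : SmallForceDomination f t₀ m) :
    Theses.TaylorCertificates.SteadyStatesLoudBounded := by
  sorry


/-! ### Card `kelvin-batchelor-work-coboundary` — the forced Kelvin–Batchelor law -/

/-- **First lemma of card `kelvin-batchelor-work-coboundary` (provable now).**
A finite Borel measure `μ` on `T³` is invariant under the flow of the smooth divergence-free field
`u` iff it is a weak solution of the stationary continuity equation, `∫ ⟪u, ∇φ⟫ dμ = 0` for every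
smooth `φ` (Liouville).  For a steady state `u` of `NS_ν(f)` the Bernoulli head `H = |u|²/2 + p`
is smooth and `u·∇H = ⟪νΔu + f, u⟫` pointwise (classical form of the steady equation,
`isSteady_iff_exists_pressure` of Disproof.lean §11, dotted with `u`; `⟪(u·∇)u, u⟫ = u·∇(|u|²/2)`),
so testing invariance with `φ = H` gives: THE WORK EQUALS THE VISCOUS TERM ON EVERY INVARIANT
MEASURE OF THE STATE'S OWN FLOW.  With `μ = volume` this is the energy identity; with `μ` an
ergodic component, an invariant torus, a closed streamline or a stagnation point it localises it. -/
theorem work_eq_viscous_on_invariantMeasure (ν : ℝ) (f u : 𝕋³ → E³) (hf : IsTest f)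
    (hu : IsSteady ν f u) (μ : Measure 𝕋³) [IsFiniteMeasure μ]
    (hinv : ∀ φ : 𝕋³ → ℝ, Torus.IsSmooth φ → ∫ x, inner ℝ (u x) (Torus.gradient φ x) ∂μ = 0) :
    ∫ x, inner ℝ (f x + ν • Torus.laplacian u x) (u x) ∂μ = 0 := by
  sorry

/-- Density form (absolutely continuous invariant measures = first integrals, since `div u = 0`):
for every smooth first integral `ψ` of a steady state `u` (`u·∇ψ = 0`),
`∫ ψ ⟪f, u⟫ = −ν ∫ ψ ⟪Δu, u⟫` (`= ν∫ψ|∇u|² − (ν/2)∫ψ Δ|u|²`).  Provable now by testing the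
classical steady equation against the divergence-free field `ψu`
(`∫ψ⟪∇p,u⟫ = 0`, `∫ψ u·∇(|u|²/2) = 0`). -/
theorem work_eq_viscous_firstIntegral (ν : ℝ) (f u : 𝕋³ → E³) (ψ : 𝕋³ → ℝ) (hf : IsTest f)
    (hu : IsSteady ν f u) (hψ : Torus.IsSmooth ψ)
    (hfi : ∀ x, inner ℝ (u x) (Torus.gradient ψ x) = 0) :
    ∫ x, ψ x * inner ℝ (f x) (u x) = -ν * ∫ x, ψ x * inner ℝ (Torus.laplacian u x) (u x) := by
  sorry

/-- Kelvin–Batchelor form: along a CLOSED STREAMLINE of a steady state (an integral curve of `u`,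
written through a lift `Γ : ℝ → ℝ³` that closes up on the torus after time `T`), the circulation of
the force is paid exactly by viscosity: `∮ (f + νΔu)·dl = 0`, i.e.
`∫₀ᵀ ⟪f(γ t) + νΔu(γ t), u(γ t)⟫ dt = 0` (Batchelor 1956's closed-streamline condition with the
body force kept; steady forced Kelvin theorem).  Provable now: `t ↦ H(γ t)` has derivative
`⟪νΔu + f, u⟫(γ t)` and `H(γ T) = H(γ 0)`. -/
theorem kelvin_batchelor_closedStreamline (ν T : ℝ) (f u : 𝕋³ → E³) (hf : IsTest f)
    (hu : IsSteady ν f u) (Γ : ℝ → EuclideanSpace ℝ (Fin 3))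
    (hΓ : ∀ t, HasDerivAt Γ (Torus.lift u (Γ t)) t) (hT : 0 < T)
    (hclosed : Torus.proj (Γ T) = Torus.proj (Γ 0)) :
    ∫ t in (0 : ℝ)..T, inner ℝ (f (Torus.proj (Γ t)) + ν • Torus.laplacian u (Torus.proj (Γ t)))
      (u (Torus.proj (Γ t))) = 0 := by
  sorry

/-- The leading-order teeth of the law at SHEAR skeletons (used by cards 1 and 3): for a shear field
`V = φ(k·x) d` (`d ⊥ k`) every field `G = g(k·x) e` with `e ⊥ k` — the whole `k`-SECTOR — annihilates
the range of the linearised Lamb map: `∫ ⟪(V·∇)w + (w·∇)V, G⟫ = 0` for all smooth div-free mean-zero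
`w` (one integration by parts along `d`, plus `⟨w·k⟩_{planes} ≡ 0`).  Hence a force absorbed at
linear order by a shear skeleton must have NO Fourier modes on the line `ℝk` (sector test), and the
planar means of momentum flux across the planes `k·x = c` are exact constants of every steady state
in every unforced direction. Stated for smooth profiles through the lift `x ↦ k·x`. -/
theorem shear_sector_mem_cokernel (φ g : ℝ → ℝ) (hφ : ContDiff ℝ ⊤ φ) (hg : ContDiff ℝ ⊤ g)
    (hφ1 : Function.Periodic φ 1) (hg1 : Function.Periodic g 1)
    (k : Fin 3 → ℤ) (d e : E³) (hk : k ≠ 0)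
    (hd : ∑ i, (k i : ℝ) * d i = 0) (he : ∑ i, (k i : ℝ) * e i = 0)
    (V G w : 𝕋³ → E³)
    (hV : ∀ y : EuclideanSpace ℝ (Fin 3), V (Torus.proj y) = φ (∑ i, (k i : ℝ) * y i) • d)
    (hG : ∀ y : EuclideanSpace ℝ (Fin 3), G (Torus.proj y) = g (∑ i, (k i : ℝ) * y i) • e)
    (hw : IsTest w) :
    ∫ x, inner ℝ (Torus.convect V w x + Torus.convect w V x) (G x) = 0 := by
  sorry

end Summit.AnomalousDissipation.AnomalousDissipation.Cruxes.SteadyStatesLoudBounded.Sketch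

end
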